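import Mathlib
import HarnessLib
import Literature.MathematicalPhysics.QuantumFieldTheory.YangMillsOS
import Literature.MathematicalPhysics.QuantumLattice.LatticeGaugeDLR

/-!
# Sketch — crux stmt-QuantumFields-8646 (HypercubicLimit), idea `conditional-mean-telescoping`

First checkable statements of the line (they need not be proved here; they must elaborate):

* `TelescopingIdentity` / `TelescopingBound` — the abstract probability lemma (Markov + tower):
  separated-point moments are moments of products of conditional means, hence bounded by the
  `n`-th power of ONE `Lⁿ` influence norm.
* `influenceNorm` — the object: `‖E_β[δP₀ | links outside the cube Q_R]‖_{Lᵖ}` on the Wilson torus.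
* `influenceNorm_antitone` — exact monotonicity in `R` (conditional expectation contracts `Lᵖ`).
* `InfluenceHypercontractivity`, `BoundedEffectiveExponent` — the two scale-free window cruxes.
-/

open MeasureTheory Filter
open scoped ENNReal

namespace Summit.QuantumFields.YangMills.Cruxes.HypercubicLimit.ConditionalMeanTelescoping

/-! ## 1. Abstract telescoping (pure probability; provable now from Mathlib's condExp API) -/

/-- **Telescoping identity.** On a probability space, let `Φ i` (`i < n`) be bounded integrable real
functions and `F i` sub-σ-algebras such that (a) `Φ j` is `F i`-measurable for `j ≠ i` (the other
points lie outside the `i`-th cube) and (b) `E[Φ i | F i]` is `F j`-measurable for `j ≠ i` (Markov: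
the conditional mean lives on the shell of the `i`-th cube, which lies outside the `j`-th cube).
Then `E[∏ Φ i] = E[∏ E[Φ i | F i]]`. (Induction on `i`, pulling the `F i`-measurable factors out of
`μ[· | F i]` with `condExp_mul_of_stronglyMeasurable_left` and `integral_condExp`.) -/
def TelescopingIdentity : Prop :=
  ∀ (Ω : Type) (m₀ : MeasurableSpace Ω) (μ : Measure Ω) [IsProbabilityMeasure μ] (n : ℕ)
    (F : Fin n → MeasurableSpace Ω) (Φ : Fin n → Ω → ℝ),
    (∀ i, F i ≤ m₀) →
    (∀ i, Integrable (Φ i) μ) → (∀ i, ∃ C : ℝ, ∀ ω, |Φ i ω| ≤ C) →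
    (∀ i j, i ≠ j → StronglyMeasurable[F i] (Φ j)) →
    (∀ i j, i ≠ j → StronglyMeasurable[F j] (μ[Φ i | F i])) →
      ∫ ω, ∏ i, Φ i ω ∂μ = ∫ ω, ∏ i, (μ[Φ i | F i]) ω ∂μ

/-- **Telescoping bound** (generalised Hölder on the identity): under the same hypotheses,
`|E[∏ Φ i]| ≤ ∏ i ‖E[Φ i | F i]‖_{Lⁿ(μ)}`. With translation invariance all factors are equal:
`|⟨∏ δP_{x_i}⟩| ≤ I_n(R)ⁿ`. -/
def TelescopingBound : Prop :=
  ∀ (Ω : Type) (m₀ : MeasurableSpace Ω) (μ : Measure Ω) [IsProbabilityMeasure μ] (n : ℕ)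
    (F : Fin n → MeasurableSpace Ω) (Φ : Fin n → Ω → ℝ),
    (∀ i, F i ≤ m₀) →
    (∀ i, Integrable (Φ i) μ) → (∀ i, ∃ C : ℝ, ∀ ω, |Φ i ω| ≤ C) →
    (∀ i j, i ≠ j → StronglyMeasurable[F i] (Φ j)) →
    (∀ i j, i ≠ j → StronglyMeasurable[F j] (μ[Φ i | F i])) →
      |∫ ω, ∏ i, Φ i ω ∂μ| ≤ ∏ i, (eLpNorm (μ[Φ i | F i]) (n : ℝ≥0∞) μ).toReal

/-! ## 2. The object on the Wilson torus: the influence profile of the curvature species -/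

open Literature.MathematicalPhysics.QuantumFieldTheory Literature.MathematicalPhysics.QuantumLattice
  Literature.Probability.LatticeModels

variable {G : Type} [Group G] [TopologicalSpace G] [IsTopologicalGroup G] [CompactSpace G]
  [MeasurableSpace G] [BorelSpace G]

/-- Edges of `ℤ⁴` interior to the `ℓ^∞`-cube of radius `R` around the site `x`
(both endpoints in the cube). -/
def cubeEdgesZd (R : ℕ) (x : Site 4) : Set (ZdEdge 4) :=
  {e | (∀ μ, |e.1 μ - x μ| ≤ R) ∧ ∀ μ, |e.1 μ + (if μ = e.2 then 1 else 0) - x μ| ≤ R}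

/-- Their images on the torus of side `S` (the cube must fit: `2R + 2 < S`). -/
def cubeEdgesTorus (S R : ℕ) (x : Site 4) : Set (Edge 4 S) :=
  torusEdge S '' cubeEdgesZd R x

/-- The **exterior σ-algebra** of the cube: cylinder events of the torus links NOT interior to
`Q_R(x)` (Mathlib `cylinderEvents`). -/
@[reducible] def exteriorEvents (S R : ℕ) (x : Site 4) : MeasurableSpace (GaugeConfig 4 S G) :=
  cylinderEvents (X := fun _ : Edge 4 S => G) (cubeEdgesTorus S R x)ᶜ

/-- The torus curvature field at the `ℤ⁴`-site `x` (action density of `r`, periodically lifted). -/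
noncomputable def torusCurvature (r : LatticeRep G) (S : ℕ) (x : Site 4) (U : GaugeConfig 4 S G) : ℝ :=
  r.curvature.F (configShift (-x) (torusLift S U))

/-- **Influence profile** `I_p(β, S, R) := ‖ E_{β,S}[ P₀ − ⟨P₀⟩ | exterior of Q_R(0) ] ‖_{Lᵖ}` of
the curvature species on the symmetric torus of side `2S+1` — ONE observable, ONE cube. -/
noncomputable def influenceNorm (r : LatticeRep G) (β : ℝ) (S R : ℕ) (p : ℝ≥0∞) : ℝ≥0∞ :=
  let μ := wilsonMeasure (d := 4) (L := 2 * S + 1) r.ρ β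
  let δP : GaugeConfig 4 (2 * S + 1) G → ℝ :=
    fun U => torusCurvature r (2 * S + 1) 0 U - ∫ V, torusCurvature r (2 * S + 1) 0 V ∂μ
  eLpNorm (μ[δP | exteriorEvents (2 * S + 1) R 0]) p μ

/-- The axial plaquette-channel two-point function on the same torus (the `A(β,R)` of the card):
connected correlation of the curvature species with its time-translate by `R`. -/
noncomputable def axialTwoPoint (r : LatticeRep G) (β : ℝ) (S R : ℕ) : ℝ :=
  latticeConnectedCorr r.ρ β (2 * S + 1) r.curvature.F r.curvature.F R

/-- **(M) Exact monotonicity.** For `1 ≤ p` the influence profile is non-increasing in the cube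
radius: `Q_R ⊆ Q_{R'}` gives `exterior(R') ≤ exterior(R)`, the tower property and the `Lᵖ`
contractivity of conditional expectation (`eLpNorm_condExp_le_eLpNorm`). Provable now. -/
def influenceNorm_antitone : Prop :=
  ∀ (G : Type) [Group G] [TopologicalSpace G] [IsTopologicalGroup G] [CompactSpace G]
    [MeasurableSpace G] [BorelSpace G] (r : LatticeRep G) (β : ℝ) (S : ℕ) (p : ℝ≥0∞), 1 ≤ p →
    ∀ R R' : ℕ, R ≤ R' → 2 * R' + 2 < 2 * S + 1 →
      influenceNorm r β S R' p ≤ influenceNorm r β S R p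

/-- **First lemma of the line (Wilson-torus instance of the telescoping bound).** For plaquette
sites `x i` pairwise more than `2R+1` apart in `ℓ^∞` (so each curvature observable lies outside
the other cubes and each shell lies outside the other cubes — Markov property of the
nearest-neighbour Wilson specification), the torus `n`-point function of the centred curvature
field is bounded by the `n`-th power of ONE influence norm:
`|⟨∏ᵢ δP_{xᵢ}⟩_{β,S}| ≤ I_n(β,S,R)ⁿ`. -/
def WilsonTelescopingBound : Prop :=
  ∀ (G : Type) [Group G] [TopologicalSpace G] [IsTopologicalGroup G] [CompactSpace G]
    [MeasurableSpace G] [BorelSpace G] (r : LatticeRep G) (β : ℝ) (S R n : ℕ)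
    (x : Fin n → Site 4),
    4 * R + 4 < 2 * S + 1 →
    (∀ i j, i ≠ j → ∃ μ : Fin 4, (2 * R + 1 : ℤ) < |x i μ - x j μ| ∧ |x i μ - x j μ| ≤ S) →
      let μ := wilsonMeasure (d := 4) (L := 2 * S + 1) r.ρ β
      |∫ U, ∏ i, (torusCurvature r (2 * S + 1) (x i) U -
          ∫ V, torusCurvature r (2 * S + 1) (x i) V ∂μ) ∂μ|
        ≤ (influenceNorm r β S R n).toReal ^ n

/-! ## 3. The two scale-free window cruxes (ONE observable, below the correlation length) -/

/-- The IR datum the window is measured against: an all-pairs, volume-uniform lattice gap at a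
rate `m(β) > 0` along `β ≥ β₁` (shape of `ModularSelfDualFold.WeakCouplingLatticeGap`,
stmt-QuantumFields-8901), COMPARABLE to the plaquette's own decay rate (`m_P ≤ C₁ m`: beyond
`c₂/m(β)` the axial effective mass is at most `C₁ m(β)`), with `m(β) → 0` (`XiDiverges`, 8941). -/
def OneScaleLatticeGap (G : Type) [Group G] [TopologicalSpace G] [IsTopologicalGroup G]
    [CompactSpace G] [MeasurableSpace G] [BorelSpace G] (r : LatticeRep G) (β₁ C₁ c₂ : ℝ)
    (m : ℝ → ℝ) : Prop :=
  (∀ β : ℝ, β₁ ≤ β → 0 < m β) ∧ Tendsto m atTop (nhds 0) ∧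
  (∀ A B : YMSpecies G, ∃ (C : ℝ) (S₀ : ℕ), ∀ β : ℝ, β₁ ≤ β → ∀ S : ℕ, S₀ ≤ S → ∀ n : ℕ, n ≤ S →
      |latticeConnectedCorr r.ρ β (2 * S + 1) A.F B.F n| ≤ C * Real.exp (-(m β * n))) ∧
  (∀ β : ℝ, β₁ ≤ β → ∃ S₀ : ℕ, ∀ S : ℕ, S₀ ≤ S → ∀ n : ℕ, c₂ / m β ≤ n → n + 1 ≤ S →
      axialTwoPoint r β S (n + 1) ≥ Real.exp (-(C₁ * m β)) * axialTwoPoint r β S n)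

/-- **(WI) Influence hypercontractivity / corner-free influence** (crux, rank 2 of the line):
below a fixed fraction of the correlation length, the `Lⁿ` influence of the cube exterior on the
curvature observable is at most `C n^γ` times the square root of the axial two-point function at
the cube radius — for every `n`, uniformly in `β` and in the volume. (Exactly true with `C = 1`,
`n = 2` for a HALF-SPACE by reflection positivity; the bet is that the 8 faces of a cube and the
higher `Lⁿ` norms cost only constants: conditional means are dominated by linear response.) -/
def InfluenceHypercontractivity : Prop :=
  ∀ (G : Type) [Group G] [TopologicalSpace G] [IsTopologicalGroup G] [CompactSpace G]
    [MeasurableSpace G] [BorelSpace G], IsCompactSimpleLieGroup G →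
    ∀ (r : LatticeRep G) (β₁ C₁ c₂ : ℝ) (m : ℝ → ℝ), OneScaleLatticeGap G r β₁ C₁ c₂ m →
      ∃ (C γ c₀ β₀ : ℝ), 0 < c₀ ∧ ∀ β : ℝ, β₀ ≤ β → ∀ n : ℕ, 2 ≤ n → ∃ S₀ : ℕ, ∀ S : ℕ, S₀ ≤ S →
        ∀ R : ℕ, 1 ≤ R → (R : ℝ) ≤ c₀ / m β →
          (influenceNorm r β S R n).toReal ≤ C * (n : ℝ) ^ γ * Real.sqrt (axialTwoPoint r β S R)

/-- **(W2) Bounded effective exponent** (crux, rank 3 of the line): below the same fraction of the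
correlation length the axial two-point function has polynomial doubling,
`A(β,R) ≤ C (R'/R)^p A(β,R')` for `1 ≤ R ≤ R' ≤ c₀/m(β)` — no intermediate exponential regime
between the lattice scale and the mass gap (equivalently `R·m_eff(β,R) ≤ p`). -/
def BoundedEffectiveExponent : Prop :=
  ∀ (G : Type) [Group G] [TopologicalSpace G] [IsTopologicalGroup G] [CompactSpace G]
    [MeasurableSpace G] [BorelSpace G], IsCompactSimpleLieGroup G →
    ∀ (r : LatticeRep G) (β₁ C₁ c₂ : ℝ) (m : ℝ → ℝ), OneScaleLatticeGap G r β₁ C₁ c₂ m →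
      ∃ (C p c₀ β₀ : ℝ), 0 < c₀ ∧ ∀ β : ℝ, β₀ ≤ β → ∃ S₀ : ℕ, ∀ S : ℕ, S₀ ≤ S →
        ∀ R R' : ℕ, 1 ≤ R → R ≤ R' → (R' : ℝ) ≤ c₀ / m β →
          axialTwoPoint r β S R ≤ C * ((R' : ℝ) / R) ^ p * axialTwoPoint r β S R'

/-- The off-axis two-point function entering the transverse clause: connected torus correlation of
the curvature species at the origin with its translate by the lattice vector `z`. -/
noncomputable def twoPointAt (r : LatticeRep G) (β : ℝ) (S : ℕ) (z : Site 4) : ℝ :=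
  let μ := wilsonMeasure (d := 4) (L := 2 * S + 1) r.ρ β
  (∫ U, torusCurvature r (2 * S + 1) 0 U * torusCurvature r (2 * S + 1) z U ∂μ) -
    (∫ U, torusCurvature r (2 * S + 1) 0 U ∂μ) * ∫ U, torusCurvature r (2 * S + 1) z U ∂μ

/-- **(W2b) Transverse cone comparability** (companion of (W2), same stub): below the correlation
length the two-point function inside a cone of fixed opening around the time axis is comparable
from below to its axial value — no transverse sign oscillation at scales `≫ a`. It is what turns
the axial normalisation into a SMEARED (test-function) one, making `IsNontrivial` automatic and
matching E0′ to fixed Schwartz test functions without rotation invariance. -/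
def TransverseConeComparability : Prop :=
  ∀ (G : Type) [Group G] [TopologicalSpace G] [IsTopologicalGroup G] [CompactSpace G]
    [MeasurableSpace G] [BorelSpace G], IsCompactSimpleLieGroup G →
    ∀ (r : LatticeRep G) (β₁ C₁ c₂ : ℝ) (m : ℝ → ℝ), OneScaleLatticeGap G r β₁ C₁ c₂ m →
      ∃ (c θ c₀ β₀ : ℝ), 0 < c ∧ 0 < θ ∧ 0 < c₀ ∧ ∀ β : ℝ, β₀ ≤ β → ∃ S₀ : ℕ, ∀ S : ℕ, S₀ ≤ S →
        ∀ (R : ℕ) (z : Site 4), 1 ≤ R → (R : ℝ) ≤ c₀ / m β → z 0 = R →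
          (∀ i : Fin 4, i ≠ 0 → |(z i : ℝ)| ≤ θ * R) →
            c * axialTwoPoint r β S R ≤ twoPointAt r β S z

/-- **Consequence the line is built for (Gaussian domination of separated moments).**
`WilsonTelescopingBound ∧ InfluenceHypercontractivity` give, for plaquette sites pairwise more
than `2R+1` apart with `R ≤ c₀/m(β)`:
`|⟨∏ᵢ δP_{xᵢ}⟩_{β,S}| ≤ (C n^γ)ⁿ A(β,R)^{n/2}` — the separated `n`-point function is at most
`(C n^γ)ⁿ` times the `(n/2)`-th power of the two-point function at half the separation; with
`BoundedEffectiveExponent` and the normalisation `c_k² A(β_k, δ₀/a_k) = δ₀⁻⁸` this is `k`-uniform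
E0′ on `⁰𝒮` for the renormalised curvature species, with growth `(n!)^γ`. -/
def GaussianDominationOfSeparatedMoments : Prop :=
  ∀ (G : Type) [Group G] [TopologicalSpace G] [IsTopologicalGroup G] [CompactSpace G]
    [MeasurableSpace G] [BorelSpace G], IsCompactSimpleLieGroup G →
    ∀ (r : LatticeRep G) (β₁ C₁ c₂ : ℝ) (m : ℝ → ℝ), OneScaleLatticeGap G r β₁ C₁ c₂ m →
      ∃ (C γ c₀ β₀ : ℝ), 0 < c₀ ∧ ∀ β : ℝ, β₀ ≤ β → ∀ n : ℕ, 2 ≤ n → ∃ S₀ : ℕ, ∀ S : ℕ, S₀ ≤ S →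
        ∀ (R : ℕ) (x : Fin n → Site 4), 1 ≤ R → (R : ℝ) ≤ c₀ / m β → 4 * R + 4 < 2 * S + 1 →
          (∀ i j, i ≠ j → ∃ μ : Fin 4, (2 * R + 1 : ℤ) < |x i μ - x j μ| ∧ |x i μ - x j μ| ≤ S) →
            let μ := wilsonMeasure (d := 4) (L := 2 * S + 1) r.ρ β
            |∫ U, ∏ i, (torusCurvature r (2 * S + 1) (x i) U -
                ∫ V, torusCurvature r (2 * S + 1) (x i) V ∂μ) ∂μ|
              ≤ (C * (n : ℝ) ^ γ * Real.sqrt (axialTwoPoint r β S R)) ^ n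

/-- The first glue of the line is elementary: the torus telescoping bound and hypercontractivity
give Gaussian domination (`t ↦ tⁿ` is monotone on `ℝ≥0`). -/
theorem gaussianDomination_of (hT : WilsonTelescopingBound) (hI : InfluenceHypercontractivity) :
    GaussianDominationOfSeparatedMoments := by
  intro G _ _ _ _ _ _ hG r β₁ C₁ c₂ m hL
  obtain ⟨C, γ, c₀, β₀, hc₀, h⟩ := hI G hG r β₁ C₁ c₂ m hL
  refine ⟨C, γ, c₀, β₀, hc₀, fun β hβ n hn => ?_⟩
  obtain ⟨S₀, hS⟩ := h β hβ n hn
  refine ⟨S₀, fun S hS' R x hR hRc hfit hsep => ?_⟩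
  have h1 := hT G r β S R n x hfit hsep
  have h2 := hS S hS' R hR hRc
  refine le_trans h1 (pow_le_pow_left₀ ENNReal.toReal_nonneg h2 n)

end Summit.QuantumFields.YangMills.Cruxes.HypercubicLimit.ConditionalMeanTelescoping
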